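import Literature.MathematicalPhysics.QuantumFieldTheory.Balaban1983to89.B15Prop1Carrier
import Literature.MathematicalPhysics.QuantumFieldTheory.Balaban1983to89.BlockAveragingPlaquetteBound

/-!
# `Balaban1983to89.B15Prop1ChartDeviation` — T. Bałaban, *Large field renormalization. I. The basic step of the 𝐑 operation*,
Commun. Math. Phys. **122** (1989) 175–202 [Balaban1989LargeFieldI] («[IV]»), Proposition 1 (1.78) p. 194 with p. 193: the
CHART-DEVIATION item (c4) ∕ (d4) of the Proposition-1 dictionaries (`B15Prop1CarrierOnFromModel.prop1Printed_lfVarOn_of_model`,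
`B15Prop1FromModel.prop1Printed_of_model`) REDUCED to its two printed inputs — the one-plaquette algebra
`|(exp(iA)·V)(∂p′) − 1| ≤ |V(∂p′) − 1| + Σ_{b⊂∂p′}|exp(iA(b)) − 1|` (PROVED, by name from the tree's
`BlockAveragingPlaquetteBound.dist1_plaquette_with_corr_le`) and the two located letters it leaves: the chart's
one-bond Lipschitz bound `|exp(iX) − 1| ≤ κ|X|` and the p. 193 extension bound *«|∂V_k − 1| < O(1)M²ε»*.

statement-level skeleton of published theorems with citation tags; proofs where landed; nothing here is a claim about
the Yang–Mills mass gap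

Cell pub-ymgap, HUMAN RULING D-0062 (Track A full width), seat `pub-ymgap-dag-n12-c` (R134 acceleration seat (a), strategy s1 of
DAG node N12 = [B15]; sixth product; the leaf is lit-balaban-type-B15's OFFER (α) of its CLOSE line, typed here on the
consumer side).  PDFs held: `paper:balaban1989-cmp122-large-field-i` (journal page = PDF page + 174; pp. 193–194 = PDF 19–20,
text layer re-read by this seat 2026-08-26).

THE PRINT.  p. 194 (1.78): *«It satisfies the regularity condition |V_Λ(∂p′) − 1| < B₅M⁵ε for p′ ∈ Λ.»*  [LF-II] p. 359: *«we
can write V′ = exp iB′ … it can be bounded by 2γ₀⁻¹2d(100M)⁵B₃²4ε_k. This proves … the bound (1.78) [IV].»*  p. 193: *«we get a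
configuration V_k defined on the whole domain, equal to the given one on Z∩Λᶜ, and satisfying the regularity condition
|∂V_k − 1| < O(1)M²ε.»*  So `V_Λ = exp(iB′)·Ṽ_k` and `|V_Λ(∂p′) − 1| ≤ |Ṽ_k(∂p′) − 1| + 4·max_{b⊂∂p′}|exp(iB′(b)) − 1| ≤ O(1)M²ε
+ 4κ‖B′‖` — the shape `a‖B′‖ + bM²ε` of the dictionaries' (c4) ∕ (d4).

WHAT THIS FILE PROVES (theorems only; Mathlib + `B15Prop1Carrier` + `BlockAveragingPlaquetteBound`; no `sorry`, no definition,
no `… : Prop` fact; axioms standard).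
§1 **`dist1_plaqHol_expMul_le`** — for every chart `ch`, bond field `A`, configuration `V` and plaquette `p`:
   `dist1 ((exp(iA)·V)(∂p)) ≤ dist1 (V(∂p)) + Σ_{the four bonds of p} dist1 (exp(iA(b)))` (PROVED: `plaqHol` is the word
   `U₁U₂U₃⁻¹U₄⁻¹` and `expMul` multiplies each letter on the left; `dist1_plaquette_with_corr_le`).
   `dist1_plaqHol_expMul_le_of_forall` — with a uniform one-bond bound `t`: `≤ dist1 (V(∂p)) + 4t`.
§2 **`chartDeviation_of_letters`** — the hypothesis (c4) of `prop1Printed_lfVarOn_of_model` (per instance `i`, `ε`-regular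
   datum `V_k`, gauge-fixed `B′` of the ball, plaquette `p′` meeting `Λ^{(k)}`: `dist1 ((φ B′)(∂p′)) ≤ a‖B′‖ + b·M²ε`) SUPPLIED,
   with `a = 4κ`, for any chart of the printed form `φ i V_k B′ = expMul ch (ιA i V_k B′) (ext i V_k)` from the two located
   letters: (ℓ1) `dist1 (ch.iexp ((ιA i V_k B′) b)) ≤ κ‖B′‖` on every bond (one-bond Lipschitz bound of the exponential chart
   composed with `|B′(b)| ≤ ‖B′‖`), (ℓ2) `dist1 ((ext i V_k)(∂p′)) ≤ b·M²ε` for `p′` meeting `Λ^{(k)}` on `ε`-regular data (the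
   p. 193 extension; r12's `B15Extension193.extension_of_surfaceGauge` proves this shape for a parallelepiped from the
   surface-gauge datum).

HONEST SCOPE.  (ℓ1) and (ℓ2) are displayed, not discharged: the abstract `ExpChart` carries no Lipschitz property (for the
matrix exponential on `su(N)` with the operator norm `‖e^{iX} − 1‖ ≤ ‖X‖` it holds with `κ = 1`), and the extension of record
is NODE 00's to pin.  Count-neutral; NOT summit progress.
-/

noncomputable section

open Set

namespace Literature.MathematicalPhysics.QuantumFieldTheory.Balaban1983to89.B15Prop1ChartDeviation

open Literature.MathematicalPhysics.QuantumFieldTheory.Balaban1983to89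
open B15DeterminingSets GaugeField B16Sect1Backgrounds B15Prop1Carrier B8Eq17ClassAkV1

variable {P : Params}

/-! ## §1 One plaquette: the chart factors cost at most their own deviations -/

section OnePlaquette

variable {G : Type*} [GaugeGroup G] {𝔤 : Type*} [AddCommGroup 𝔤] [Module ℝ 𝔤] (ch : ExpChart G 𝔤) {k : ℕ}

/-- **`|(exp(iA)·V)(∂p) − 1| ≤ |V(∂p) − 1| + Σ_{b⊂∂p}|exp(iA(b)) − 1|`** — the plaquette variable of the chart configuration
`exp(iA)·V` (`expMul`: each bond variable multiplied on the left by `exp(iA(b))`) deviates from `1` by at most the deviation of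
`V(∂p)` plus the deviations of the four chart factors (the group algebra of `BlockAveragingPlaquetteBound.dist1_plaquette_with_corr_le`,
B7 (19): `|g⁻¹ − 1| = |g − 1|`, `|hgh⁻¹ − 1| = |g − 1|`, `|gh − 1| ≤ |g − 1| + |h − 1|`).  The step behind *«V′ = exp iB′ … This
proves … the bound (1.78)»*. [cite: Balaban1989LargeFieldI, Prop. 1 (1.78) p.194; Balaban1989LargeFieldII, p.359] -/
theorem dist1_plaqHol_expMul_le (A : VecField P k 𝔤) (V : GaugeField P k G) (p : Plaq P k) :
    dist1 (plaqHol (expMul ch A V) p) ≤ dist1 (plaqHol V p) +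
      (dist1 (ch.iexp (A ⟨p.src, p.μ⟩)) + dist1 (ch.iexp (A ⟨p.src.shift p.μ, p.ν⟩)) +
        dist1 (ch.iexp (A ⟨p.src.shift p.ν, p.μ⟩)) + dist1 (ch.iexp (A ⟨p.src, p.ν⟩))) :=
  BlockAveragingPlaquetteBound.dist1_plaquette_with_corr_le _ _ _ _ _ _ _ _

/-- With a UNIFORM one-bond bound `dist1 (exp(iA(b))) ≤ t`: `|(exp(iA)·V)(∂p) − 1| ≤ |V(∂p) − 1| + 4t`.
[cite: Balaban1989LargeFieldI, Prop. 1 (1.78) p.194] -/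
theorem dist1_plaqHol_expMul_le_of_forall (A : VecField P k 𝔤) (V : GaugeField P k G) (p : Plaq P k) {t : ℝ}
    (ht : ∀ b : PBond P k, dist1 (ch.iexp (A b)) ≤ t) :
    dist1 (plaqHol (expMul ch A V) p) ≤ dist1 (plaqHol V p) + 4 * t := by
  have h := dist1_plaqHol_expMul_le ch A V p
  have h1 := ht ⟨p.src, p.μ⟩
  have h2 := ht ⟨p.src.shift p.μ, p.ν⟩
  have h3 := ht ⟨p.src.shift p.ν, p.μ⟩
  have h4 := ht ⟨p.src, p.ν⟩
  linarith

end OnePlaquette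

/-! ## §2 The dictionary item (c4): the chart deviation from the two located letters -/

section Dictionary

variable {G : Type} [GaugeGroup G] {𝔤 : Type*} [AddCommGroup 𝔤] [Module ℝ 𝔤] (ch : ExpChart G 𝔤)

/-- **(c4) SUPPLIED from the two letters.**  For a chart of the printed form `φ i V_k B′ = expMul ch (ιA i V_k B′) (ext i V_k)`
(`V′Ṽ_k` with `V′ = exp iB′`, `ιA` the bond field of the gauge-fixed coordinate `B′`, `ext` the fixed extension of the datum):
if (ℓ1) every chart factor satisfies `dist1 (exp(i(ιA B′)(b))) ≤ κ‖B′‖` and (ℓ2) on `ε`-regular data the extension satisfies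
`dist1 (Ṽ_k(∂p′)) ≤ b·M²ε` for the plaquettes `p′` meeting `Λ^{(k)}` (p. 193), then the hypothesis (c4) of
`B15Prop1CarrierOnFromModel.prop1Printed_lfVarOn_of_model` holds with `a = 4κ`:
`dist1 ((φ B′)(∂p′)) ≤ 4κ‖B′‖ + b·M²ε`. [cite: Balaban1989LargeFieldI, Prop. 1 (1.78) p.194, p.193 («satisfying the regularity
condition |∂V_k − 1| < O(1)M²ε»)] -/
theorem chartDeviation_of_letters {ι : Type} (I : ι → InstOn P G) {E : ι → Type*} [∀ i, NormedAddCommGroup (E i)]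
    (P₀ : ∀ i, E i → E i) (r : ι → ℝ)
    (φ : ∀ i, GaugeField P (I i).k G → E i → GaugeField P (I i).k G)
    (ιA : ∀ i, GaugeField P (I i).k G → E i → VecField P (I i).k 𝔤)
    (ext : ∀ i, GaugeField P (I i).k G → GaugeField P (I i).k G)
    (hφ : ∀ i Vk B, φ i Vk B = expMul ch (ιA i Vk B) (ext i Vk))
    {κ b : ℝ}
    (hexp : ∀ i Vk (B : E i) (bb : PBond P (I i).k), P₀ i B = B → ‖B‖ ≤ r i →
      dist1 (ch.iexp (ιA i Vk B bb)) ≤ κ * ‖B‖)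
    (hext : ∀ i ε Vk, 0 < ε → (lfVarOn ch I).Regular i ε Vk →
      ∀ p ∈ plaqsOf (pts (I i).k (I i).Λ), dist1 (plaqHol (ext i Vk) p) ≤ b * (I i).M ^ 2 * ε) :
    ∀ i ε Vk (B : E i), 0 < ε → (lfVarOn ch I).Regular i ε Vk → P₀ i B = B → ‖B‖ ≤ r i →
      ∀ p ∈ plaqsOf (pts (I i).k (I i).Λ), dist1 (plaqHol (φ i Vk B) p) ≤ 4 * κ * ‖B‖ + b * (I i).M ^ 2 * ε := by
  intro i ε Vk B hε hreg hBg hBn p hp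
  rw [hφ]
  have h := dist1_plaqHol_expMul_le_of_forall ch (ιA i Vk B) (ext i Vk) p (fun bb => hexp i Vk B bb hBg hBn)
  have h' := hext i ε Vk hε hreg p hp
  linarith

end Dictionary

end Literature.MathematicalPhysics.QuantumFieldTheory.Balaban1983to89.B15Prop1ChartDeviation

end
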